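import Summits.QuantumFields.BalabanUV.T4Continuum.Support.VariationalTaxiCoarse
import Summits.QuantumFields.BalabanUV.T4Continuum.Support.VariationalCovariantTower

/-!
# T⁴ programme, spine node NE2 (U1a), road P2 supplier item (O10) — THE NESTED-vs-STRAIGHT RELATIVE PHASE OF THE TAXI TOWER:
# the composite transport «level-`n` taxi to the `L`-block, then the one-step taxi inside it» read against the straight level-`n·L` taxi
# differs from it by a U(1) phase within `d(L−1)·(d−1)·(nL + L − 2)·a` of `1` (`a` the fine plaquette defect) — summable over the tower

NE2 formalisation swarm, leaf prover 01 (gen 4); INTENT CLAIMS.log l.10863; answers the road owner t4-ne2-p2-g11's located finding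
N-ne2p2g11-2 (l.10594): the END's binders hold jointly only if the NESTED composite transports `T_{k+1} = compT (T_k) (T′_k)` (COMP⁺) are read
against a REFERENCE transport with small in-block defect — the straight taxi — through a relative phase `‖T·conj T₀ − 1‖ ≤ γ` («hrel»; the
owner's repair (R1)–(R3) and this lineage's `VariationalCovariantPoincareLocal.nsq_le_covariant_poincare_rel`).  THIS FILE supplies γ for taxi data:
 * §1 transport of straight legs and plaquettes along the block nesting `sites n L M : Tor (fine (n·L) M) ≃ Tor (fine L (fine n M))`
   (`piT_sites`, `plaq_Rtr`), concatenation of straight legs (`piT_add`), the straight coarse phases chained into fine legs (`piT_coarseT`),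
   digit bookkeeping (`below_J`, `J_update_succ`, `J_succ_lt`), and THE BASE CASE `taxi_coarseT_eq`: the level-`n` taxi through
   `coarseT R′` IS the level-`n·L` straight taxi to the `L`-block corner (both are the product of the same fine bonds along the same path);
 * §2 ONE BOND AT A TIME inside the `L`-block: the `μ`-step identities of BOTH taxis (leaf-04-g2's `taxi_succ` at side `L` and at side `n·L`)
   multiply the relative phase by `hol_L·conj hol_{nL}`, `‖hol_L − 1‖ ≤ (d−1)(L−1)a`, `‖hol_{nL} − 1‖ ≤ (d−1)(nL−1)a` (`norm_hol_sub_one_le`);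
   induction on the digit sum gives **`norm_nested_mul_conj_straight_sub_one_le`**:
   `‖taxi_n (coarseT R′) y j₂ · taxi_L R′ (bpt n M y j₂) j₁ · conj (taxi_{n·L} (R′∘sites) y (J j₂ j₁)) − 1‖ ≤ (Σ_μ j₁ μ)·((d−1)(L−1) + (d−1)(nL−1))·a`,
   and §2b its site form **`norm_compT_taxi_mul_conj_taxiT_sub_one_le`**: for every `x : Tor (fine (n·L) M)`,
   `‖compT n L M (taxiT_n (coarseT R′)) (taxiT_L R′) x · conj (taxiT_{n·L} (Rtr R′) x) − 1‖ ≤ d(L−1)·((d−1)(L−1) + (d−1)(nL−1))·a`;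
 * §3 COMPOSITION with an arbitrary unit nested transport at level `n` (**`norm_compT_rel_step`**: `hrel` at level `n` with `γ` ⟹ `hrel` at level
   `n·L` with `γ + d(L−1)((d−1)(L−1) + (d−1)(nL−1))a` — the induction step of the tower), and the SCALE CHECK `step_le` ∕ **`step_le_of_class`**:
   the step is `≤ 2d²·n·L²·a ≤ 2d²·c/n` under the class `(n·L)²·a ≤ c` — summable along `n = L^k` (`Σ_k 2d²c/L^k ≤ 2d²c·L/(L−1)`), so the
   tower's γ is k-UNIFORM and O(c) — summed in the sequel `Support/VariationalTaxiNestedTower` (`tower_hrel`: R3's `hrel` binder for ANY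
   COMP⁺ tower over coherent taxi data; the owner's numerics: γ ≈ 0.27 at α = 0.3, d = 2).

HONEST FRAMING (T4-DAG p. 1).  Abelian lattice gauge geometry (discrete Stokes on rectangles) about OUR typed taxi objects (leaf-04-g2's
`VariationalTaxiTransport`∕`…Coarse`, leaf-02-g3's `compT`∕`Rtr`); model level (U(1), unit phases DATA); [folklore]; nothing printed is a
hypothesis ([Balaban1985BackgroundPropagators] (3.15)∕(3.19) p.393 «U(Γ)» SHAPE only); no `def … : Prop`; no `sorry`.  By itself changes no END:
it is the `hrel` INPUT of the owner's (R1)–(R3); NE2 NOT proved on either road; spine 0/9; rung (B)+1 finite T⁴ — NOT infinite volume, NOT mass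
gap, NOT Clay.  HONEST DEPENDENCY: continuum YM on T⁴ ⇐ BetaPertH ∧ nine spine estimates (0/9 proved); BetaPertH ⇐ (D1) ∧ (D4) ∧ CAP+tail;
G-an2-4 gates asym, D1 and NE2/3/4.
-/

noncomputable section

open scoped BigOperators ComplexConjugate
open Finset

namespace Summit.QuantumFields.BalabanUV.T4Continuum.VariationalTaxiNested

open Literature.MathematicalPhysics.QuantumFieldTheory.Balaban1983to89.B5Prop11Plancherel (Tor fine unitVec)
open Literature.MathematicalPhysics.QuantumFieldTheory.Balaban1983to89.B5Block118 (tstep tstep_zero tstep_succ bpt up iota up_add)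
open Literature.MathematicalPhysics.QuantumFieldTheory.Balaban1983to89.B5Blocks16 (blockOf blockOf_bpt bpt_bijective)
open Literature.MathematicalPhysics.QuantumFieldTheory.Balaban1983to89.B5Composition116 (sites bpt_bpt J J_val up_tstep recast_add recast_tstep fine_fine
  tstep_add JEquiv JEquiv_apply)
open Summit.QuantumFields.BalabanUV.T4Continuum.ScalarBlockTrialFunction (digits digits_bpt)
open Summit.QuantumFields.BalabanUV.T4Continuum.VariationalCovariantFederbush (piT)
open Summit.QuantumFields.BalabanUV.T4Continuum.VariationalCovariantUpperBound (mul_conj_of_norm_one)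
open Summit.QuantumFields.BalabanUV.T4Continuum.VariationalTower (sites_unitVec)
open Summit.QuantumFields.BalabanUV.T4Continuum.VariationalCovariantTower (compT Rtr sites_add)
open Summit.QuantumFields.BalabanUV.T4Continuum.VariationalTaxiTransport
open Summit.QuantumFields.BalabanUV.T4Continuum.VariationalTaxiCoarse (coarseT)

variable {d : ℕ}

/-! ## §0 An elementary fact about unit phases -/

/-- `‖u·v − 1‖ ≤ ‖u − 1‖ + ‖v − 1‖` for `‖u‖ ≤ 1`. [folklore] -/
theorem norm_mul_sub_one_le_add {u v : ℂ} (hu : ‖u‖ ≤ 1) : ‖u * v - 1‖ ≤ ‖u - 1‖ + ‖v - 1‖ := by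
  have e : u * v - 1 = u * (v - 1) + (u - 1) := by ring
  rw [e, add_comm ‖u - 1‖]
  refine (norm_add_le _ _).trans (add_le_add ?_ le_rfl)
  rw [norm_mul]
  exact mul_le_of_le_one_left (norm_nonneg _) hu

/-! ## §1 Straight legs along the block nesting; the base case -/

section Nesting

variable (n L : ℕ) [NeZero n] [NeZero L] (M : Fin d → ℕ) [hM : ∀ μ, NeZero (M μ)]

omit [NeZero n] [NeZero L] hM in
/-- `sites (t e_μ) = t e_μ`. [folklore] -/
theorem sites_tstep (μ : Fin d) (t : ℕ) : sites n L M (tstep (fine (n * L) M) μ t) = tstep (fine L (fine n M)) μ t := by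
  unfold sites; exact recast_tstep (fine_fine n L M) μ t

omit [NeZero n] [NeZero L] hM in
/-- straight legs read through `sites`: `piT_{n·L} (R′∘sites) p μ t = piT R′ (sites p) μ t`. [folklore] -/
theorem piT_sites (R' : Tor (fine L (fine n M)) → Fin d → ℂ) (p : Tor (fine (n * L) M)) (μ : Fin d) (t : ℕ) :
    piT (n * L) M (Rtr n L M R') p μ t = piT L (fine n M) R' (sites n L M p) μ t := by
  induction t with
  | zero => simp [piT]
  | succ t ih => simp only [piT, ih, Rtr, sites_add, sites_tstep]

omit [NeZero n] [NeZero L] hM in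
/-- plaquettes read through `sites`. [folklore] -/
theorem plaq_Rtr (R' : Tor (fine L (fine n M)) → Fin d → ℂ) (x : Tor (fine (n * L) M)) (κ ν : Fin d) :
    plaq (n * L) M (Rtr n L M R') x κ ν = plaq L (fine n M) R' (sites n L M x) κ ν := by
  simp only [plaq, Rtr, sites_add, sites_unitVec]

omit [NeZero n] [NeZero L] hM in
/-- concatenation of straight legs: `piT p μ (s + t) = piT p μ s · piT (p + s e_μ) μ t`. [folklore] -/
theorem piT_add {Lb : ℕ} {N : Fin d → ℕ} (R : Tor (fine Lb N) → Fin d → ℂ) (p : Tor (fine Lb N)) (μ : Fin d) (s t : ℕ) :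
    piT Lb N R p μ (s + t) = piT Lb N R p μ s * piT Lb N R (p + tstep (fine Lb N) μ s) μ t := by
  induction t with
  | zero => simp [piT]
  | succ t ih =>
    rw [← add_assoc]
    simp only [piT, ih, tstep_add, add_assoc, mul_assoc]

omit [NeZero n] hM in
/-- the `L`-block corner of a shifted coarse site: `bpt (c + t e_μ) 0 = bpt c 0 + (L t) e_μ`. [folklore] -/
theorem bpt_zero_add_tstep (c : Tor (fine n M)) (μ : Fin d) (t : ℕ) :
    bpt L (fine n M) (c + tstep (fine n M) μ t) 0 = bpt L (fine n M) c 0 + tstep (fine L (fine n M)) μ (L * t) := by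
  have h0 : iota L (fine n M) (0 : Fin d → Fin L) = 0 := by funext ν; simp [iota]
  simp only [bpt, h0, add_zero, up_add, up_tstep]

omit [NeZero n] hM in
/-- **the straight coarse phases chain into straight fine legs**: `piT_n (coarseT R′) c μ t = piT R′ (bpt c 0) μ (L·t)`. [folklore] -/
theorem piT_coarseT (R' : Tor (fine L (fine n M)) → Fin d → ℂ) (c : Tor (fine n M)) (μ : Fin d) (t : ℕ) :
    piT n M (coarseT L (fine n M) R') c μ t = piT L (fine n M) R' (bpt L (fine n M) c 0) μ (L * t) := by
  induction t with
  | zero => simp [piT]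
  | succ t ih =>
    rw [show L * (t + 1) = L * t + L by ring, piT_add R' (bpt L (fine n M) c 0) μ (L * t) L, ← ih]
    show piT n M (coarseT L (fine n M) R') c μ t * coarseT L (fine n M) R' (c + tstep (fine n M) μ t) μ = _
    rw [coarseT, bpt_zero_add_tstep]

omit hM in
/-- the switched-on digits of a combined offset are the combined switched-on digits. [folklore] -/
theorem below_J (j₂ : Fin d → Fin n) (j₁ : Fin d → Fin L) (i : ℕ) :
    below (n * L) (J n L j₂ j₁) i = J n L (below n j₂ i) (below L j₁ i) := by
  funext κ
  apply Fin.ext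
  simp only [below, J_val]
  split_ifs <;> simp [J_val]

omit [NeZero n] [NeZero L] hM in
/-- one more fine step in direction `μ` inside the `L`-block raises the combined digit by one. [folklore] -/
theorem J_update_succ (j₂ : Fin d → Fin n) (j₁ : Fin d → Fin L) (μ : Fin d) (h : (j₁ μ : ℕ) + 1 < L)
    (h' : (J n L j₂ j₁ μ : ℕ) + 1 < n * L) :
    J n L j₂ (Function.update j₁ μ ⟨(j₁ μ : ℕ) + 1, h⟩) = Function.update (J n L j₂ j₁) μ ⟨(J n L j₂ j₁ μ : ℕ) + 1, h'⟩ := by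
  funext κ
  apply Fin.ext
  by_cases hκ : κ = μ
  · subst hκ; simp [J_val, Function.update_self]; ring
  · simp [J_val, Function.update_of_ne hκ]

omit [NeZero n] [NeZero L] hM in
/-- the combined digit stays inside the big block: `J_μ + 1 < n·L` when `j₁ μ + 1 < L`. [folklore] -/
theorem J_succ_lt (j₂ : Fin d → Fin n) (j₁ : Fin d → Fin L) (μ : Fin d) (h : (j₁ μ : ℕ) + 1 < L) :
    (J n L j₂ j₁ μ : ℕ) + 1 < n * L := by
  rw [J_val]
  have h2 : (j₂ μ : ℕ) + 1 ≤ n := (j₂ μ).is_lt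
  nlinarith [Nat.zero_le (j₂ μ : ℕ), Nat.zero_le L]

omit hM in
/-- the taxi to the block base point is trivial: `taxi R y 0 = 1`. [folklore] -/
theorem taxi_zero {Lb : ℕ} [NeZero Lb] {N : Fin d → ℕ} [∀ μ, NeZero (N μ)] (R : Tor (fine Lb N) → Fin d → ℂ) (y : Tor N) :
    taxi Lb N R y 0 = 1 := by
  unfold taxi
  refine Finset.prod_eq_one fun i _ => ?_
  unfold leg
  split_ifs with h
  · simp [piT]
  · rfl

/-- **THE BASE CASE**: the level-`n` taxi through the straight coarse phases `coarseT R′` IS the level-`n·L` straight taxi to the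
`L`-block corner: `taxi n (coarseT R′) y j₂ = taxi (n·L) (R′∘sites) y (J j₂ 0)` (the same fine bonds along the same path). [folklore] -/
theorem taxi_coarseT_eq (R' : Tor (fine L (fine n M)) → Fin d → ℂ) (y : Tor M) (j₂ : Fin d → Fin n) :
    taxi n M (coarseT L (fine n M) R') y j₂ = taxi (n * L) M (Rtr n L M R') y (J n L j₂ 0) := by
  unfold taxi
  refine Finset.prod_congr rfl fun i hi => ?_
  have hid : i < d := Finset.mem_range.mp hi
  have h0 : below L (0 : Fin d → Fin L) i = 0 := by funext κ; simp [below]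
  have hJ : (J n L j₂ 0 ⟨i, hid⟩ : ℕ) = L * (j₂ ⟨i, hid⟩ : ℕ) := by rw [J_val]; simp
  simp only [leg, dif_pos hid]
  rw [piT_coarseT, piT_sites, corner, corner, below_J, h0, ← bpt_bpt, hJ]

end Nesting

/-! ## §2 One bond at a time inside the `L`-block: the relative phase of the nested and the straight taxi -/

/-- holonomies of unit phases are unit. [folklore] -/
theorem norm_hol_eq_one {Lb : ℕ} [NeZero Lb] {N : Fin d → ℕ} [∀ μ, NeZero (N μ)] {R : Tor (fine Lb N) → Fin d → ℂ}
    (hR : ∀ x μ, ‖R x μ‖ = 1) (y : Tor N) (j : Fin d → Fin Lb) (μ : Fin d) : ‖hol Lb N R y j μ‖ = 1 := by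
  unfold hol
  refine norm_prod_eq_one _ _ fun i _ => ?_
  split_ifs with h
  · exact norm_prod_eq_one _ _ fun t _ => norm_plaq Lb N hR _ _ _
  · simp

section Step

variable (n L : ℕ) [NeZero n] [NeZero L] (M : Fin d → ℕ) [hM : ∀ μ, NeZero (M μ)]
variable {R' : Tor (fine L (fine n M)) → Fin d → ℂ} (hR1 : ∀ x μ, ‖R' x μ‖ = 1)
include hR1

omit [NeZero n] [NeZero L] hM in
/-- the transported phases are unit. [folklore] -/
theorem norm_Rtr (x : Tor (fine (n * L) M)) (μ : Fin d) : ‖Rtr n L M R' x μ‖ = 1 := hR1 _ _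

omit [NeZero n] [NeZero L] hM hR1 in
/-- the transported plaquette defect. [folklore] -/
theorem norm_plaq_Rtr_sub_one_le {a : ℝ} (ha : ∀ x κ ν, ‖plaq L (fine n M) R' x κ ν - 1‖ ≤ a)
    (x : Tor (fine (n * L) M)) (κ ν : Fin d) : ‖plaq (n * L) M (Rtr n L M R') x κ ν - 1‖ ≤ a := by
  rw [plaq_Rtr]; exact ha _ _ _

/-- **THE RELATIVE PHASE OF THE NESTED AND THE STRAIGHT TAXI** (digits form): for unit fine phases `R′` with plaquette defect `a`, the
level-`n` taxi through `coarseT R′` to the `L`-block at `j₂`, continued by the one-step taxi to the digit `j₁` inside it, read against the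
straight level-`n·L` taxi to the combined digit `J j₂ j₁`, is a phase within `(Σ_μ j₁ μ)·((d−1)(L−1) + (d−1)(nL−1))·a` of `1` — one bond of the
inner taxi at a time: each `μ`-step multiplies the relative phase by `hol_L·conj hol_{nL}` (leaf-04-g2's `taxi_succ` at side `L` and at side
`n·L`). [folklore] -/
theorem norm_nested_mul_conj_straight_sub_one_le {a : ℝ} (ha : ∀ x κ ν, ‖plaq L (fine n M) R' x κ ν - 1‖ ≤ a)
    (y : Tor M) (j₂ : Fin d → Fin n) (j₁ : Fin d → Fin L) :
    ‖taxi n M (coarseT L (fine n M) R') y j₂ * taxi L (fine n M) R' (bpt n M y j₂) j₁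
        * conj (taxi (n * L) M (Rtr n L M R') y (J n L j₂ j₁)) - 1‖
      ≤ ((∑ μ, (j₁ μ : ℕ) : ℕ) : ℝ)
        * ((((d - 1 : ℕ) : ℝ) * ((L - 1 : ℕ) : ℝ) + ((d - 1 : ℕ) : ℝ) * ((n * L - 1 : ℕ) : ℝ)) * a) := by
  set K : ℝ := (((d - 1 : ℕ) : ℝ) * ((L - 1 : ℕ) : ℝ) + ((d - 1 : ℕ) : ℝ) * ((n * L - 1 : ℕ) : ℝ)) * a with hK
  have hRc1 : ∀ y' μ, ‖coarseT L (fine n M) R' y' μ‖ = 1 := fun y' μ => VariationalTaxiCoarse.norm_coarseT L (fine n M) hR1 y' μ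
  have hRb1 : ∀ x μ, ‖Rtr n L M R' x μ‖ = 1 := norm_Rtr n L M hR1
  -- induction on the digit sum of the inner taxi
  suffices key : ∀ (s : ℕ) (j : Fin d → Fin L), (∑ μ, (j μ : ℕ)) = s →
      ‖taxi n M (coarseT L (fine n M) R') y j₂ * taxi L (fine n M) R' (bpt n M y j₂) j
          * conj (taxi (n * L) M (Rtr n L M R') y (J n L j₂ j)) - 1‖ ≤ (s : ℝ) * K from key _ j₁ rfl
  intro s
  induction s with
  | zero =>
    intro j hs
    have hj : j = 0 := by
      funext μ
      have h := (Finset.sum_eq_zero_iff.mp hs) μ (Finset.mem_univ μ)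
      exact Fin.ext h
    subst hj
    rw [taxi_zero, mul_one, ← taxi_coarseT_eq, (mul_conj_of_norm_one (norm_taxi n M hRc1 y j₂)).1, sub_self, norm_zero, Nat.cast_zero, zero_mul]
  | succ s ih =>
    intro j hs
    obtain ⟨μ, -, hμ⟩ := Finset.exists_ne_zero_of_sum_ne_zero (s := Finset.univ) (f := fun κ => (j κ : ℕ))
      (by rw [hs]; exact Nat.succ_ne_zero s)
    have hμ' : 0 < (j μ : ℕ) := Nat.pos_of_ne_zero hμ
    -- the predecessor digits `j₀ = j − δ_μ`
    set j₀ : Fin d → Fin L := Function.update j μ ⟨(j μ : ℕ) - 1, by have := (j μ).is_lt; omega⟩ with hj₀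
    have hj₀μ : (j₀ μ : ℕ) = (j μ : ℕ) - 1 := by simp [hj₀]
    have h0lt : (j₀ μ : ℕ) + 1 < L := by rw [hj₀μ]; have := (j μ).is_lt; omega
    have hj : j = Function.update j₀ μ ⟨(j₀ μ : ℕ) + 1, h0lt⟩ := by
      funext κ
      by_cases hκ : κ = μ
      · subst hκ; apply Fin.ext; simp [hj₀]; omega
      · simp [hj₀, Function.update_of_ne hκ]
    have hs₀ : (∑ κ, (j₀ κ : ℕ)) = s := by
      have e3 : ∀ κ, (j₀ κ : ℕ) = Function.update (fun κ => (j κ : ℕ)) μ ((j μ : ℕ) - 1) κ := by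
        intro κ
        by_cases hκ : κ = μ
        · subst hκ; simp [hj₀]
        · simp [hj₀, Function.update_of_ne hκ]
      have e1 := Finset.sum_update_of_mem (Finset.mem_univ μ) (fun κ => (j κ : ℕ)) ((j μ : ℕ) - 1)
      have e2 := Finset.add_sum_erase (Finset.univ : Finset (Fin d)) (fun κ => (j κ : ℕ)) (Finset.mem_univ μ)
      rw [Finset.sdiff_singleton_eq_erase] at e1
      rw [Finset.sum_congr rfl fun κ _ => e3 κ, e1]
      omega
    have IH := ih j₀ hs₀
    -- the μ-steps of both taxis, ending on the same fine bond
    have hJlt := J_succ_lt n L j₂ j₀ μ h0lt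
    rw [hj, J_update_succ n L j₂ j₀ μ h0lt hJlt, taxi_succ L (fine n M) hR1 (bpt n M y j₂) j₀ μ h0lt,
      taxi_succ (n * L) M hRb1 y (J n L j₂ j₀) μ hJlt]
    have hb : Rtr n L M R' (bpt (n * L) M y (J n L j₂ j₀)) μ = R' (bpt L (fine n M) (bpt n M y j₂) j₀) μ := by
      rw [Rtr, ← bpt_bpt]
    rw [hb]
    set N := taxi n M (coarseT L (fine n M) R') y j₂ with hN
    set τL := taxi L (fine n M) R' (bpt n M y j₂) j₀ with hτL
    set τB := taxi (n * L) M (Rtr n L M R') y (J n L j₂ j₀) with hτB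
    set gL := hol L (fine n M) R' (bpt n M y j₂) j₀ μ with hgL
    set gB := hol (n * L) M (Rtr n L M R') y (J n L j₂ j₀) μ with hgB
    set b := R' (bpt L (fine n M) (bpt n M y j₂) j₀) μ with hbdef
    have hbb : b * conj b = 1 := (mul_conj_of_norm_one (hR1 _ _)).1
    have e : N * (gL * (τL * b)) * conj (gB * (τB * b)) - 1 = N * τL * conj τB * (gL * conj gB) - 1 := by
      rw [map_mul, map_mul]
      linear_combination (N * τL * conj τB * gL * conj gB) * hbb
    rw [e]
    have hu : ‖N * τL * conj τB‖ ≤ 1 := by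
      rw [norm_mul, norm_mul, Complex.norm_conj, hN, hτL, hτB, norm_taxi n M hRc1, norm_taxi L (fine n M) hR1,
        norm_taxi (n * L) M hRb1]
      norm_num
    have hg : ‖gL‖ ≤ 1 := (norm_hol_eq_one hR1 _ _ _).le
    have h1 : ‖gL - 1‖ ≤ ((d - 1 : ℕ) : ℝ) * ((L - 1 : ℕ) : ℝ) * a := norm_hol_sub_one_le L (fine n M) hR1 _ _ μ ha
    have h2 : ‖conj gB - 1‖ ≤ ((d - 1 : ℕ) : ℝ) * ((n * L - 1 : ℕ) : ℝ) * a := by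
      rw [← Complex.norm_conj, map_sub, map_one, Complex.conj_conj]
      exact norm_hol_sub_one_le (n * L) M hRb1 _ _ μ (norm_plaq_Rtr_sub_one_le n L M ha)
    calc ‖N * τL * conj τB * (gL * conj gB) - 1‖
        ≤ ‖N * τL * conj τB - 1‖ + ‖gL * conj gB - 1‖ := norm_mul_sub_one_le_add hu
      _ ≤ (s : ℝ) * K + (‖gL - 1‖ + ‖conj gB - 1‖) := add_le_add IH (norm_mul_sub_one_le_add hg)
      _ ≤ (s : ℝ) * K + K := by rw [hK]; nlinarith [h1, h2]
      _ = ((s + 1 : ℕ) : ℝ) * K := by push_cast; ring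

end Step

/-! ## §2b The same on the fine torus: `compT` of the two taxis against the straight level-`n·L` taxi -/

section SiteForm

variable (n L : ℕ) [NeZero n] [NeZero L] (M : Fin d → ℕ) [hM : ∀ μ, NeZero (M μ)]
variable {R' : Tor (fine L (fine n M)) → Fin d → ℂ} (hR1 : ∀ x μ, ‖R' x μ‖ = 1)
include hR1

/-- **THE NESTED-vs-STRAIGHT RELATIVE PHASE, site form**: for every site `x` of the level-`n·L` torus, the COMPOSITE transport
`compT (taxiT_n (coarseT R′)) (taxiT_L R′) x` (level-`n` taxi to the `L`-block, then the one-step taxi — the COMP⁺ shape of the END) and the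
STRAIGHT level-`n·L` taxi `taxiT_{n·L} (R′∘sites) x` differ by a phase within `d(L−1)·((d−1)(L−1) + (d−1)(nL−1))·a` of `1`. [folklore] -/
theorem norm_compT_taxi_mul_conj_taxiT_sub_one_le {a : ℝ} (ha : ∀ x κ ν, ‖plaq L (fine n M) R' x κ ν - 1‖ ≤ a)
    (x : Tor (fine (n * L) M)) :
    ‖compT n L M (taxiT n M (coarseT L (fine n M) R')) (taxiT L (fine n M) R') x * conj (taxiT (n * L) M (Rtr n L M R') x) - 1‖
      ≤ (d : ℝ) * ((L - 1 : ℕ) : ℝ)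
        * ((((d - 1 : ℕ) : ℝ) * ((L - 1 : ℕ) : ℝ) + ((d - 1 : ℕ) : ℝ) * ((n * L - 1 : ℕ) : ℝ)) * a) := by
  -- chart the site: `x = bpt y (J j₂ j₁)`
  obtain ⟨⟨y, Jx⟩, rfl⟩ := (bpt_bijective (n * L) M).2 x
  obtain ⟨⟨j₂, j₁⟩, hJ⟩ := (JEquiv n L).surjective Jx
  rw [JEquiv_apply] at hJ
  subst hJ
  have hs : sites n L M (bpt (n * L) M y (J n L j₂ j₁)) = bpt L (fine n M) (bpt n M y j₂) j₁ := (bpt_bpt n L M y j₂ j₁).symm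
  simp only [compT, hs, blockOf_bpt, taxiT_bpt]
  refine (norm_nested_mul_conj_straight_sub_one_le n L M hR1 ha y j₂ j₁).trans ?_
  set K : ℝ := (((d - 1 : ℕ) : ℝ) * ((L - 1 : ℕ) : ℝ) + ((d - 1 : ℕ) : ℝ) * ((n * L - 1 : ℕ) : ℝ)) * a with hK
  rcases Nat.eq_zero_or_pos d with hd | hd
  · subst hd
    simp
  · have ha0 : 0 ≤ a := (norm_nonneg _).trans (ha (bpt L (fine n M) (bpt n M y j₂) j₁) ⟨0, hd⟩ ⟨0, hd⟩)
    have hK0 : 0 ≤ K := by rw [hK]; positivity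
    have hsum : ((∑ μ, (j₁ μ : ℕ) : ℕ) : ℝ) ≤ (d : ℝ) * ((L - 1 : ℕ) : ℝ) := by
      have h1 : (∑ μ, (j₁ μ : ℕ)) ≤ ∑ _μ : Fin d, (L - 1) :=
        Finset.sum_le_sum fun μ _ => Nat.le_sub_one_of_lt (j₁ μ).is_lt
      rw [Finset.sum_const, Finset.card_univ, Fintype.card_fin, smul_eq_mul] at h1
      exact_mod_cast h1
    exact mul_le_mul_of_nonneg_right hsum hK0

/-! ## §3 Composition with an arbitrary nested transport, and the scale check -/

/-- **COMPOSITION** (the induction step of the tower's `hrel`): if a unit level-`n` transport `T` is within `γ` of the level-`n` straight taxi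
(`‖T·conj taxiT_n − 1‖ ≤ γ` at every coarse site), then its COMP⁺ continuation by the one-step taxi is within `γ + (the step of §2b)` of the
straight level-`n·L` taxi. [folklore] -/
theorem norm_compT_rel_step {a : ℝ} (ha : ∀ x κ ν, ‖plaq L (fine n M) R' x κ ν - 1‖ ≤ a)
    {T : Tor (fine n M) → ℂ} (hT : ∀ y', ‖T y'‖ = 1) {γ : ℝ}
    (hrel : ∀ y', ‖T y' * conj (taxiT n M (coarseT L (fine n M) R') y') - 1‖ ≤ γ) (x : Tor (fine (n * L) M)) :
    ‖compT n L M T (taxiT L (fine n M) R') x * conj (taxiT (n * L) M (Rtr n L M R') x) - 1‖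
      ≤ γ + (d : ℝ) * ((L - 1 : ℕ) : ℝ)
        * ((((d - 1 : ℕ) : ℝ) * ((L - 1 : ℕ) : ℝ) + ((d - 1 : ℕ) : ℝ) * ((n * L - 1 : ℕ) : ℝ)) * a) := by
  have hRc1 : ∀ y' μ, ‖coarseT L (fine n M) R' y' μ‖ = 1 := fun y' μ => VariationalTaxiCoarse.norm_coarseT L (fine n M) hR1 y' μ
  set Y := blockOf L (fine n M) (sites n L M x) with hY
  set t := taxiT n M (coarseT L (fine n M) R') Y with ht
  have htt : conj t * t = 1 := (mul_conj_of_norm_one (norm_taxiT n M hRc1 Y)).2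
  have e : compT n L M T (taxiT L (fine n M) R') x * conj (taxiT (n * L) M (Rtr n L M R') x) - 1
      = (T Y * conj t) * (compT n L M (taxiT n M (coarseT L (fine n M) R')) (taxiT L (fine n M) R') x
          * conj (taxiT (n * L) M (Rtr n L M R') x)) - 1 := by
    simp only [compT, ← hY, ← ht]
    linear_combination (-(T Y * taxiT L (fine n M) R' (sites n L M x) * conj (taxiT (n * L) M (Rtr n L M R') x))) * htt
  rw [e]
  have hu : ‖T Y * conj t‖ ≤ 1 := by rw [norm_mul, Complex.norm_conj, hT, ht, norm_taxiT n M hRc1]; norm_num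
  exact (norm_mul_sub_one_le_add hu).trans (add_le_add (hrel Y) (norm_compT_taxi_mul_conj_taxiT_sub_one_le n L M hR1 ha x))

end SiteForm

/-- **THE SCALE CHECK**: the step `d(L−1)·((d−1)(L−1) + (d−1)(nL−1))·a ≤ 2d²·n·L²·a`. [folklore] -/
theorem step_le (d n L : ℕ) (hn : 1 ≤ n) {a : ℝ} (ha : 0 ≤ a) :
    (d : ℝ) * ((L - 1 : ℕ) : ℝ) * ((((d - 1 : ℕ) : ℝ) * ((L - 1 : ℕ) : ℝ) + ((d - 1 : ℕ) : ℝ) * ((n * L - 1 : ℕ) : ℝ)) * a)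
      ≤ 2 * (d : ℝ) ^ 2 * n * (L : ℝ) ^ 2 * a := by
  set D : ℝ := ((d - 1 : ℕ) : ℝ) with hD
  set L1 : ℝ := ((L - 1 : ℕ) : ℝ) with hL1
  set NL : ℝ := ((n * L - 1 : ℕ) : ℝ) with hNL
  have hL : L1 ≤ L := by rw [hL1]; exact_mod_cast Nat.sub_le L 1
  have hd : D ≤ d := by rw [hD]; exact_mod_cast Nat.sub_le d 1
  have hnL : NL ≤ (n : ℝ) * L := by rw [hNL]; exact_mod_cast Nat.sub_le (n * L) 1
  have hn' : (1 : ℝ) ≤ n := by exact_mod_cast hn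
  have h0L : (0 : ℝ) ≤ L1 := Nat.cast_nonneg _
  have h0d : (0 : ℝ) ≤ D := Nat.cast_nonneg _
  have h0nL : (0 : ℝ) ≤ NL := Nat.cast_nonneg _
  have hd0 : (0 : ℝ) ≤ d := Nat.cast_nonneg _
  have hL0 : (0 : ℝ) ≤ L := Nat.cast_nonneg _
  have hB : D * L1 + D * NL ≤ 2 * (d : ℝ) * ((n : ℝ) * L) := by
    have h1 : D * L1 ≤ (d : ℝ) * L := mul_le_mul hd hL h0L hd0
    have h2 : D * NL ≤ (d : ℝ) * ((n : ℝ) * L) := mul_le_mul hd hnL h0nL hd0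
    have h3 : (d : ℝ) * L ≤ (d : ℝ) * ((n : ℝ) * L) := by
      refine mul_le_mul_of_nonneg_left ?_ hd0
      nlinarith
    linarith
  calc (d : ℝ) * L1 * ((D * L1 + D * NL) * a) ≤ (d : ℝ) * L * ((2 * (d : ℝ) * ((n : ℝ) * L)) * a) := by
        gcongr
    _ = 2 * (d : ℝ) ^ 2 * n * (L : ℝ) ^ 2 * a := by ring

/-- **… and under the scale-invariant class** `(n·L)²·a ≤ c`: the step is `≤ 2d²·c/n` — summable along the tower `n = L^k`
(`Σ_k 2d²c/L^k ≤ 2d²c·L/(L−1)`), so the NESTED-vs-STRAIGHT relative phase is k-UNIFORM and `O(c)`. [folklore] -/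
theorem step_le_of_class (d n L : ℕ) (hn : 1 ≤ n) {a c : ℝ} (ha : 0 ≤ a) (hclass : ((n : ℝ) * L) ^ 2 * a ≤ c) :
    (d : ℝ) * ((L - 1 : ℕ) : ℝ) * ((((d - 1 : ℕ) : ℝ) * ((L - 1 : ℕ) : ℝ) + ((d - 1 : ℕ) : ℝ) * ((n * L - 1 : ℕ) : ℝ)) * a)
      ≤ 2 * (d : ℝ) ^ 2 * c / n := by
  have hn0 : (0 : ℝ) < n := by exact_mod_cast hn
  refine (step_le d n L hn ha).trans ?_
  rw [le_div_iff₀ hn0]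
  have e : 2 * (d : ℝ) ^ 2 * n * (L : ℝ) ^ 2 * a * n = 2 * (d : ℝ) ^ 2 * (((n : ℝ) * L) ^ 2 * a) := by ring
  rw [e]
  exact mul_le_mul_of_nonneg_left hclass (by positivity)

end Summit.QuantumFields.BalabanUV.T4Continuum.VariationalTaxiNested

end
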